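import Summits.Parity.BatemanHorn.Theorems.AlmostPrimeZerosSystemLSDRealSegmentNairClassFourTerms
import HarnessLib

/-!
# Nair–Tenenbaum light, IX: class IV (Rankin with the uniform exponent, summed over `r`)

Crux `SystemLSDRealSegment` (stmt-Parity-11292, route `AlmostPrimeZeros`), line `beta-thinned-root-kernel`,
support programme of the lead c8: **Nair–Tenenbaum "light"** — the sharp-order upper bound
`Σ_{1≤n≤N} G(F(n)) ≤ C · N · exp(Σ_{p≤N} (G(p) − 1) ρ_F(p)/p)` for a polynomial `F ∈ ℤ[X]` (degree `≥ 1`, positive on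
`ℕ_{≥1}`, root counts `ρ_F(p) ≤ D`, `ρ_F(p) < p`, `ρ_F(p^a) ≤ M`) and every weight `G ≥ 0`, `G(1) = 1`, multiplicative on
coprime arguments with `G(p^v) ≤ A` (M. Nair, Acta Arith. 62 (1992); Nair–Tenenbaum, Acta Math. 180 (1998), Thm 1 —
the special case of the class bounded at prime powers), by Shiu's method (J. reine angew. Math. 313 (1980), §5) run on the
values `m = F(n)`: cut `m = c·d` at `√N` (`Shiu.cutPrime/cPart/dPart`), four classes, the beta upper-bound sieve of dimension
`2D` on the root classes of `c`, Hall–Tenenbaum's Theorem 01 and Rankin's trick with a uniform exponent for the `c`-sums.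
Applied (file `…NairUpperBound`) to the product polynomial of a Bateman–Horn system with `G = y^{capped}` it gives
`Σ_{n≤x} y^{s_f(n)} ≪ x (log x)^{k(y−1)}`, i.e. `H_x(y) = O(1)` on the real segment — the upper half of the order of
magnitude predicted by the crux (lower half: `sumPowStat_lower_bound`, landed).  Everything here is PROVED; no definitions.

This file: `class4_le`: cut prime `L < P < N^{c₀}` and smooth part `> N^{1/4}`: `≤ C N exp(Σ (G−1)ρ/p)`, with the constant `L = L(F, A)`; assembly of the slices of `…ClassFourTerms`.
-/

open Finset Real Polynomial

namespace Summit.Parity.BatemanHorn.Cruxes.SystemLSDRealSegment.BetaThinnedRootKernel.Nair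

open Literature.NumberTheory.Sieve

noncomputable section

section Main

variable {F : ℤ[X]} {D M : ℕ} {A : ℝ}

set_option maxHeartbeats 800000 in
/-- **Class IV** (`c > N^{1/4}`, `L < P < N^{c₀}`: Rankin with the uniform exponent `η_r = c' r/log N^{c₀}` on the
`N^{c₀/r}`-smooth `c`, sieve of the cofactor by the primes `< N^{c₀/(r+1)}`, summed over `r`):
`Σ ≤ C N exp(Σ_{p ≤ N} (G(p) − 1)ρ(p)/p)` for a suitable constant `L = L(F, A) ≥ 2`. [folklore] -/
theorem class4_le (hd : 1 ≤ F.natDegree) (hpos : ∀ n : ℕ, 1 ≤ n → 0 < F.eval (n : ℤ))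
    (hD : ∀ p : ℕ, p.Prime → polyRootCountMod ![F] p ≤ D) (hD1 : 1 ≤ D)
    (hfix : ∀ p : ℕ, p.Prime → polyRootCountMod ![F] p < p)
    (hM : ∀ p : ℕ, p.Prime → ∀ a : ℕ, 1 ≤ a → polyRootCountMod ![F] (p ^ a) ≤ M) (hM1 : 1 ≤ M) (hA : 1 ≤ A) :
    ∃ L : ℝ, 2 ≤ L ∧ ∃ C : ℝ, 0 < C ∧ ∃ N₀ : ℕ, ∀ G : ℕ → ℝ, (∀ n, 0 ≤ G n) → G 1 = 1 →
      (∀ m n : ℕ, m.Coprime n → G (m * n) = G m * G n) →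
      (∀ p : ℕ, p.Prime → ∀ v : ℕ, 1 ≤ v → G (p ^ v) ≤ A) →
      ∀ N : ℕ, N₀ ≤ N →
        ∑ n ∈ (Icc 1 N).filter (fun n : ℕ => Real.sqrt N < (F.eval (n : ℤ)).toNat ∧
              (Shiu.cutPrime (Real.sqrt N) (F.eval (n : ℤ)).toNat : ℝ) < (N : ℝ) ^ (1 / (4 * (18 * (D : ℝ) + 1))) ∧
              (N : ℝ) ^ (1 / 4 : ℝ) < (Shiu.cPart (Real.sqrt N) (F.eval (n : ℤ)).toNat : ℝ) ∧
              L < (Shiu.cutPrime (Real.sqrt N) (F.eval (n : ℤ)).toNat : ℝ)),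
            G (F.eval (n : ℤ)).toNat ≤
          C * N * Real.exp (∑ p ∈ Nat.primesLE N, (G p - 1) * polyRootCountMod ![F] p / p) := by
  obtain ⟨K₁, K₂, hK₁, hK₂, hcs⟩ := csum_le hpos hD hD1 hfix hM hM1 hA
  obtain ⟨K₅, hK₅, hV⟩ := densityProd_le F hD hfix
  obtain ⟨Kr, hKr⟩ := rankin_u F hD hD1 hfix hM hM1 hA
  -- constants
  set d := F.natDegree with hddef
  set Hh : ℕ := ∑ j ∈ range (F.natDegree + 1), (F.coeff j).natAbs with hHh
  set e₀ : ℝ := 1 / (4 * (18 * (D : ℝ) + 1)) with he₀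
  have hD0 : (0 : ℝ) < 18 * (D : ℝ) + 1 := by positivity
  have hDpos : (0 : ℝ) < D := by exact_mod_cast hD1
  have he₀0 : 0 < e₀ := by rw [he₀]; positivity
  have he₀1 : e₀ ≤ 1 := by rw [he₀, div_le_one (by positivity)]; nlinarith
  set B₂ : ℝ := ((d : ℝ) + 1) / e₀ with hB₂
  have hB₂0 : 0 ≤ B₂ := by rw [hB₂]; positivity
  have hlogA : 0 ≤ Real.log A := Real.log_nonneg hA
  set c' : ℝ := 4 * e₀ * (B₂ * Real.log A + 1) with hc'
  have hc'0 : 0 < c' := by rw [hc']; positivity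
  set logL : ℝ := max (3 * c') (max (8 * ((d : ℝ) + 1) * Real.log A) 2) with hlogL
  have hlogL2 : 2 ≤ logL := (le_max_right _ _).trans (le_max_right _ _)
  have hlogL3c : 3 * c' ≤ logL := le_max_left _ _
  have hlogL8 : 8 * ((d : ℝ) + 1) * Real.log A ≤ logL := (le_max_left _ _).trans (le_max_right _ _)
  have hlogLpos : 0 < logL := by linarith
  set L : ℝ := Real.exp logL with hL
  have hlogLeq : Real.log L = logL := Real.log_exp _
  have hL0 : 0 < L := Real.exp_pos _
  have hL2 : 2 ≤ L := by
    have h1 : Real.exp 2 ≤ L := Real.exp_le_exp.2 hlogL2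
    have := Real.add_one_le_exp (2 : ℝ); linarith
  set Bℓ : ℝ := 2 * D + A * D + 1 with hBℓ
  have hBℓ0 : 0 ≤ Bℓ := by rw [hBℓ]; nlinarith [hDpos.le, (show (0:ℝ) ≤ A by linarith)]
  -- threshold
  obtain ⟨N₀, hN₀⟩ : ∃ N₀ : ℕ, ∀ N : ℕ, N₀ ≤ N → (4 : ℝ) ≤ (N : ℝ) ^ e₀ ∧ Hh * 2 ^ d ≤ N ∧ 4 ≤ N := by
    refine ⟨max (⌈(4 : ℝ) ^ (1 / e₀)⌉₊) (max (Hh * 2 ^ d) 4), fun N hN => ⟨?_, ?_, ?_⟩⟩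
    · have h1 : (4 : ℝ) ^ (1 / e₀) ≤ N := (Nat.le_ceil _).trans (by exact_mod_cast (le_max_left _ _).trans hN)
      calc (4 : ℝ) = ((4 : ℝ) ^ (1 / e₀)) ^ e₀ := by
            rw [← Real.rpow_mul (by norm_num), one_div, inv_mul_cancel₀ he₀0.ne', Real.rpow_one]
        _ ≤ (N : ℝ) ^ e₀ := Real.rpow_le_rpow (by positivity) h1 he₀0.le
    · exact ((le_max_left _ _).trans (le_max_right _ _)).trans hN
    · exact ((le_max_right _ _).trans (le_max_right _ _)).trans hN
  -- the constants
  set Km : ℝ := K₁ * K₅ * (1 / e₀) ^ D * A ^ B₂ * Real.exp (Kr + A * D * (4 * D + 2) * (2 * c') * Real.exp c') *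
      ((2 * (D : ℝ)) ^ D * Real.exp (1 / 2) * 3) with hKm
  set Kℓ : ℝ := A ^ B₂ * K₂ * Real.exp (A * M + A * D * 4) * Real.exp (4 * D) *
      Real.exp (Bℓ * Real.log (Bℓ / (1 / 8) + 1)) with hKℓ
  have hApos : 0 < A ^ B₂ := Real.rpow_pos_of_pos (by linarith) _
  refine ⟨L, hL2, Km + Kℓ, by positivity, N₀, ?_⟩
  intro G hG0 hG1 hGmul hGA N hN
  obtain ⟨hz4, hNH, hN4⟩ := hN₀ N hN
  set z₀ : ℝ := (N : ℝ) ^ e₀ with hz₀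
  have hN1 : 1 < N := by omega
  have hN1r : (1 : ℝ) < N := by exact_mod_cast hN1
  have hN0 : (0 : ℝ) < N := by linarith
  have hlogN : 0 < Real.log N := Real.log_pos hN1r
  have hz₀0 : 0 < z₀ := by linarith
  have hlogz₀ : Real.log z₀ = e₀ * Real.log N := by rw [hz₀, Real.log_rpow hN0]
  have hlogz₀pos : 0 < Real.log z₀ := by rw [hlogz₀]; positivity
  set ℓ : ℝ := Real.log (Real.log N) with hℓ
  set R : ℕ := ⌊Real.log z₀ / logL⌋₊ with hR
  -- the class and the `r`-map
  set S := (Icc 1 N).filter (fun n : ℕ => Real.sqrt N < (F.eval (n : ℤ)).toNat ∧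
      (Shiu.cutPrime (Real.sqrt N) (F.eval (n : ℤ)).toNat : ℝ) < z₀ ∧
      (N : ℝ) ^ (1 / 4 : ℝ) < (Shiu.cPart (Real.sqrt N) (F.eval (n : ℤ)).toNat : ℝ) ∧
      L < (Shiu.cutPrime (Real.sqrt N) (F.eval (n : ℤ)).toNat : ℝ)) with hS
  set rf : ℕ → ℕ := fun n => ⌊Real.log z₀ / Real.log (Shiu.cutPrime (Real.sqrt N) (F.eval (n : ℤ)).toNat)⌋₊
    with hrf
  have hmaps : ∀ n ∈ S, rf n ∈ Icc 1 R := fun n hn => by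
    obtain ⟨h1, h2, -⟩ := class4_pointwise hpos hG0 hG1 hGmul hGA hA (by omega) hNH he₀0 hz₀ hB₂ hlogLeq hlogLpos hL0 hn
    exact Finset.mem_Icc.2 ⟨h1, h2⟩
  -- per-slice bounds
  have hslice := fun r => class4_slice hpos hG0 hG1 hGmul hGA hA (show 1 ≤ N by omega) hNH he₀0 hz₀ hB₂ hlogLeq hlogLpos hL0 r
  have hmainr := fun (r : ℕ) (hr : r ∈ Icc 1 R) =>
    class4_main_r hD hfix hG0 hA hN1 he₀0 he₀1 hz₀ hz4 hB₂0 hc' hlogL2 hlogL3c hK₁.le hK₅.le (hV N) (hKr G hG0 hG1 hGmul hGA)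
      (Finset.mem_Icc.1 hr).1 (Finset.mem_Icc.1 hr).2
  have hremr := fun (r : ℕ) (hr : r ∈ Icc 1 R) =>
    class4_rem_r (F := F) (D := D) hA hN1 he₀ hz₀ hz4 hB₂0 hB₂ hc'0 hlogL2 hlogL3c hlogL8 hK₂ (M := M)
      (Finset.mem_Icc.1 hr).1 (Finset.mem_Icc.1 hr).2
  have hrf2 : ∀ r ∈ Icc 1 R, 2 ≤ z₀ ^ (1 / ((r : ℝ) + 1)) ∧ z₀ ^ (1 / ((r : ℝ) + 1)) ≤ N := fun r hr => by
    obtain ⟨hw2, hwv, hvz, -⟩ := class4_rfacts hz4 hlogL2 hc'0 hlogL3c (Finset.mem_Icc.1 hr).1 (Finset.mem_Icc.1 hr).2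
    refine ⟨hw2, hwv.trans (hvz.trans ?_)⟩
    rw [hz₀]
    calc (N : ℝ) ^ e₀ ≤ (N : ℝ) ^ (1 : ℝ) := Real.rpow_le_rpow_of_exponent_le hN1r.le he₀1
      _ = N := Real.rpow_one _
  -- Step 4: sum over `r`
  have hRle : (R : ℝ) ≤ Real.exp ℓ := by
    rw [hℓ, Real.exp_log hlogN]
    calc (R : ℝ) ≤ Real.log z₀ / logL := Nat.floor_le (by positivity)
      _ ≤ Real.log z₀ / 1 := div_le_div_of_nonneg_left hlogz₀pos.le one_pos (by linarith)
      _ = e₀ * Real.log N := by rw [div_one, hlogz₀]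
      _ ≤ 1 * Real.log N := mul_le_mul_of_nonneg_right he₀1 hlogN.le
      _ = Real.log N := one_mul _
  have hlow := exp_neg_le_exp_sum (F := F) hG0 hD (show 2 ≤ N by omega)
  have hll := exp_mul_loglog_le hN1r hBℓ0 (show (0 : ℝ) < 1 / 8 by norm_num)
  have hEsplit : Real.exp (∑ p ∈ Nat.primesLE N, (G p - 1) * polyRootCountMod ![F] p / p) =
      Real.exp (∑ p ∈ Nat.primesLE N, G p * polyRootCountMod ![F] p / p) *
        Real.exp (-∑ p ∈ Nat.primesLE N, (polyRootCountMod ![F] p : ℝ) / p) := by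
    rw [sum_sub_one_mul_eq, sub_eq_add_neg, Real.exp_add]
  set EG : ℝ := Real.exp (∑ p ∈ Nat.primesLE N, G p * polyRootCountMod ![F] p / p) with hEG
  set Eρ : ℝ := Real.exp (-∑ p ∈ Nat.primesLE N, (polyRootCountMod ![F] p : ℝ) / p) with hEρ
  calc ∑ n ∈ S, G (F.eval (n : ℤ)).toNat
      = ∑ r ∈ Icc 1 R, ∑ n ∈ S.filter (fun n => rf n = r), G (F.eval (n : ℤ)).toNat :=
        (Finset.sum_fiberwise_of_maps_to hmaps _).symm
    _ ≤ ∑ r ∈ Icc 1 R, A ^ (((r : ℝ) + 1) * B₂) * ∑ c ∈ (Icc 1 ⌊Real.sqrt N⌋₊).filter (fun c : ℕ =>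
          (N : ℝ) ^ (1 / 4 : ℝ) < (c : ℝ) ∧ ∀ p ∈ c.primeFactors, (p : ℝ) < z₀ ^ (1 / (r : ℝ))),
        G c * #((Icc 1 N).filter (fun n' : ℕ => (c : ℤ) ∣ F.eval (n' : ℤ) ∧
          ∀ p ∈ Nat.primesBelow ⌈z₀ ^ (1 / ((r : ℝ) + 1))⌉₊, ¬ p ∣ c → ¬ (p : ℤ) ∣ F.eval (n' : ℤ))) :=
        Finset.sum_le_sum fun r _ => hslice r
    _ ≤ ∑ r ∈ Icc 1 R, A ^ (((r : ℝ) + 1) * B₂) *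
        (K₁ * N * (∏ p ∈ Nat.primesBelow ⌈z₀ ^ (1 / ((r : ℝ) + 1))⌉₊, (1 - (polyRootCountMod ![F] p : ℝ) / p)) *
          ∑ c ∈ (Icc 1 ⌊Real.sqrt N⌋₊).filter (fun c : ℕ =>
              (N : ℝ) ^ (1 / 4 : ℝ) < (c : ℝ) ∧ ∀ p ∈ c.primeFactors, (p : ℝ) < z₀ ^ (1 / (r : ℝ))),
            G c * polyRootCountMod ![F] c *
              (∏ p ∈ c.primeFactors, (p : ℝ) / ((p : ℝ) - polyRootCountMod ![F] p)) / c +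
         K₂ * (z₀ ^ (1 / ((r : ℝ) + 1))) ^ (18 * D + 1) * Real.log (z₀ ^ (1 / ((r : ℝ) + 1))) ^ D *
          (Real.sqrt N * Real.exp (A * M + A * D * (ℓ + 4)))) := by
        refine Finset.sum_le_sum fun r hr => ?_
        obtain ⟨hw2, hwN⟩ := hrf2 r hr
        refine mul_le_mul_of_nonneg_left ?_ (Real.rpow_pos_of_pos (by linarith) _).le
        exact hcs G hG0 hG1 hGmul hGA N hN4 _ hw2 hwN _ (Finset.filter_subset _ _)
    _ ≤ ∑ r ∈ Icc 1 R, (K₁ * K₅ * (1 / e₀) ^ D * A ^ B₂ * Real.exp (Kr + A * D * (4 * D + 2) * (2 * c') * Real.exp c') *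
          (((r : ℝ) + 1) ^ D * Real.exp (-(r : ℝ))) * N * (EG * Eρ) +
        A ^ B₂ * K₂ * Real.exp (A * M + A * D * 4) * ((N : ℝ) ^ (7 / 8 : ℝ) * Real.exp ((D + A * D) * ℓ))) := by
        refine Finset.sum_le_sum fun r hr => ?_
        rw [mul_add]
        exact add_le_add (hmainr r hr) (hremr r hr)
    _ = (K₁ * K₅ * (1 / e₀) ^ D * A ^ B₂ * Real.exp (Kr + A * D * (4 * D + 2) * (2 * c') * Real.exp c')) * N * (EG * Eρ) *
          ∑ r ∈ Icc 1 R, ((r : ℝ) + 1) ^ D * Real.exp (-(r : ℝ)) +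
        #(Icc 1 R) * (A ^ B₂ * K₂ * Real.exp (A * M + A * D * 4) * ((N : ℝ) ^ (7 / 8 : ℝ) * Real.exp ((D + A * D) * ℓ))) := by
        rw [Finset.sum_add_distrib, Finset.sum_const, nsmul_eq_mul, Finset.mul_sum]
        congr 1
        refine Finset.sum_congr rfl fun r _ => ?_
        ring
    _ ≤ (K₁ * K₅ * (1 / e₀) ^ D * A ^ B₂ * Real.exp (Kr + A * D * (4 * D + 2) * (2 * c') * Real.exp c')) * N * (EG * Eρ) *
          ((2 * (D : ℝ)) ^ D * Real.exp (1 / 2) * 3) +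
        Real.exp ℓ * (A ^ B₂ * K₂ * Real.exp (A * M + A * D * 4) * ((N : ℝ) ^ (7 / 8 : ℝ) * Real.exp ((D + A * D) * ℓ))) := by
        gcongr
        · calc ∑ r ∈ Icc 1 R, ((r : ℝ) + 1) ^ D * Real.exp (-(r : ℝ))
              ≤ ∑ r ∈ Icc 1 R, (2 * (D : ℝ)) ^ D * Real.exp (1 / 2) * Real.exp (-((r : ℝ) / 2)) :=
                Finset.sum_le_sum fun r _ => pow_mul_exp_neg_le hD1 r
            _ = (2 * (D : ℝ)) ^ D * Real.exp (1 / 2) * ∑ r ∈ Icc 1 R, Real.exp (-((r : ℝ) / 2)) := by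
                rw [Finset.mul_sum]
            _ ≤ (2 * (D : ℝ)) ^ D * Real.exp (1 / 2) * 3 :=
                mul_le_mul_of_nonneg_left (sum_exp_neg_half_le _) (by positivity)
        · calc (#(Icc 1 R) : ℝ) = R := by rw [Nat.card_Icc]; push_cast; ring
            _ ≤ Real.exp ℓ := hRle
    _ = Km * N * Real.exp (∑ p ∈ Nat.primesLE N, (G p - 1) * polyRootCountMod ![F] p / p) +
        A ^ B₂ * K₂ * Real.exp (A * M + A * D * 4) * ((N : ℝ) ^ (7 / 8 : ℝ) * Real.exp ((D + A * D + 1) * ℓ)) := by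
        rw [hEsplit, hKm]
        have : Real.exp ((D + A * D + 1) * ℓ) = Real.exp ℓ * Real.exp ((D + A * D) * ℓ) := by
          rw [← Real.exp_add]; ring_nf
        rw [this]; ring
    _ ≤ Km * N * Real.exp (∑ p ∈ Nat.primesLE N, (G p - 1) * polyRootCountMod ![F] p / p) +
        Kℓ * N * Real.exp (∑ p ∈ Nat.primesLE N, (G p - 1) * polyRootCountMod ![F] p / p) := by
        gcongr ?_ + ?_
        · exact le_rfl
        · have h5 : Real.exp ((D + A * D + 1) * ℓ) = Real.exp (Bℓ * ℓ) * Real.exp (-(D * ℓ)) := by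
            rw [← Real.exp_add, hBℓ]; ring_nf
          have h6 : Real.exp (-(D * ℓ)) = Real.exp (4 * D) * Real.exp (-(D * (ℓ + 4))) := by
            rw [← Real.exp_add]; ring_nf
          have h4 : (N : ℝ) ^ (7 / 8 : ℝ) * Real.exp ((D + A * D + 1) * ℓ) ≤
              Real.exp (4 * D) * Real.exp (Bℓ * Real.log (Bℓ / (1 / 8) + 1)) * N *
                Real.exp (∑ p ∈ Nat.primesLE N, (G p - 1) * polyRootCountMod ![F] p / p) := by
            calc (N : ℝ) ^ (7 / 8 : ℝ) * Real.exp ((D + A * D + 1) * ℓ)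
                = (N : ℝ) ^ (7 / 8 : ℝ) * Real.exp (Bℓ * ℓ) * Real.exp (-(D * ℓ)) := by rw [h5]; ring
              _ ≤ (N : ℝ) ^ (7 / 8 : ℝ) * (Real.exp (Bℓ * Real.log (Bℓ / (1 / 8) + 1)) * (N : ℝ) ^ (1 / 8 : ℝ)) *
                  Real.exp (-(D * ℓ)) := by gcongr
              _ = Real.exp (Bℓ * Real.log (Bℓ / (1 / 8) + 1)) * ((N : ℝ) ^ (7 / 8 : ℝ) * (N : ℝ) ^ (1 / 8 : ℝ)) *
                  (Real.exp (4 * D) * Real.exp (-(D * (ℓ + 4)))) := by rw [h6]; ring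
              _ = Real.exp (4 * D) * Real.exp (Bℓ * Real.log (Bℓ / (1 / 8) + 1)) * N *
                  Real.exp (-(D * (ℓ + 4))) := by rw [← Real.rpow_add hN0]; norm_num; ring
              _ ≤ Real.exp (4 * D) * Real.exp (Bℓ * Real.log (Bℓ / (1 / 8) + 1)) * N *
                  Real.exp (∑ p ∈ Nat.primesLE N, (G p - 1) * polyRootCountMod ![F] p / p) := by gcongr
          calc A ^ B₂ * K₂ * Real.exp (A * M + A * D * 4) * ((N : ℝ) ^ (7 / 8 : ℝ) * Real.exp ((D + A * D + 1) * ℓ))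
              ≤ A ^ B₂ * K₂ * Real.exp (A * M + A * D * 4) * (Real.exp (4 * D) * Real.exp (Bℓ * Real.log (Bℓ / (1 / 8) + 1)) * N *
                Real.exp (∑ p ∈ Nat.primesLE N, (G p - 1) * polyRootCountMod ![F] p / p)) :=
                mul_le_mul_of_nonneg_left h4 (by positivity)
            _ = Kℓ * N * Real.exp (∑ p ∈ Nat.primesLE N, (G p - 1) * polyRootCountMod ![F] p / p) := by
                rw [hKℓ]; ring
    _ = (Km + Kℓ) * N * Real.exp (∑ p ∈ Nat.primesLE N, (G p - 1) * polyRootCountMod ![F] p / p) := by ring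

end Main

/-- **Registered form** (`--supports stmt-Parity-11292`): class IV. [folklore] -/
theorem nair_class4_le : ∀ (F : ℤ[X]) (D M : ℕ) (A : ℝ), 1 ≤ F.natDegree → (∀ n : ℕ, 1 ≤ n → 0 < F.eval (n : ℤ)) → (∀ p : ℕ, p.Prime → polyRootCountMod ![F] p ≤ D) → 1 ≤ D → (∀ p : ℕ, p.Prime → polyRootCountMod ![F] p < p) → (∀ p : ℕ, p.Prime → ∀ a : ℕ, 1 ≤ a → polyRootCountMod ![F] (p ^ a) ≤ M) → 1 ≤ M → 1 ≤ A → ∃ L : ℝ, 2 ≤ L ∧ ∃ C : ℝ, 0 < C ∧ ∃ N₀ : ℕ, ∀ G : ℕ → ℝ, (∀ n, 0 ≤ G n) → G 1 = 1 → (∀ m n : ℕ, m.Coprime n → G (m * n) = G m * G n) → (∀ p : ℕ, p.Prime → ∀ v : ℕ, 1 ≤ v → G (p ^ v) ≤ A) → ∀ N : ℕ, N₀ ≤ N → ∑ n ∈ (Icc 1 N).filter (fun n : ℕ => Real.sqrt N < (F.eval (n : ℤ)).toNat ∧ (Shiu.cutPrime (Real.sqrt N) (F.eval (n : ℤ)).toNat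 : ℝ) < (N : ℝ) ^ (1 / (4 * (18 * (D : ℝ) + 1))) ∧ (N : ℝ) ^ (1 / 4 : ℝ) < (Shiu.cPart (Real.sqrt N) (F.eval (n : ℤ)).toNat : ℝ) ∧ L < (Shiu.cutPrime (Real.sqrt N) (F.eval (n : ℤ)).toNat : ℝ)), G (F.eval (n : ℤ)).toNat ≤ C * N * Real.exp (∑ p ∈ Nat.primesLE N, (G p - 1) * polyRootCountMod ![F] p / p) :=
  fun _F _D _M _A hd hpos hD hD1 hfix hM hM1 hA => class4_le hd hpos hD hD1 hfix hM hM1 hA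

end

end Summit.Parity.BatemanHorn.Cruxes.SystemLSDRealSegment.BetaThinnedRootKernel.Nair
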